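import Summits.ResolutionOfSingularities.ResolutionOfSingularities.Theorems.PurelyInseparableDim4ResConeSatLocated
import HarnessLib
import HarnessLib.Audit.Tags

/-!
# Purely inseparable four-folds — the TAME CONE AT A CONSTANT-`d` STEP, VIII: (T-PERSIST) — the linear form of a
# hyperplane vertex PERSISTS off the chart letter (idea-4 I-4-7 (VT)(ii) / token I47.TPERSIST, cone level)

[OURS · counted 0 · cell `res-dim4-pi` · desk WORD #66 (2) (K2(p) lower-band lane, owner p-12 g2) · seat
res-dim4-p-5 g2 · K lane crit-4 g2 (K-A4).]  Nothing here proves K2(p), `NoIsolatedTrap p p` or resolution of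
singularities in dimension ≥ 4 / characteristic `p`.

Setting (`…ResCone*`): a shade-keeping point step `s →(j, b) s′` in the band, polar kernels `V = resVertex s`,
`V′ = resVertex s′`, exceptional hyperplane `H_j = {w_j = 0}`.  SAT-LOCATED (p670701) says `V′ ∩ H_j ⊆ V ∩ H_j`;
dually, every linear form killing `V` kills `V′ ∩ H_j`.  When the vertex is a HYPERPLANE (`e_G = 3`, p-12 g2's
`…ResConePowerCone`: `g = c·ℓ^d`, `V = ker ℓ`) this pins the new form off the chart letter:

* `dotProduct_eq_zero_of_mem_resVertex_step` — ANNIHILATOR TRANSPORT (any `e_G`): `φ ⊥ V ⇒ φ ⊥ (V′ ∩ H_j)`;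
* `exists_apply_ne_zero_off_chart` — a non-zero form `ℓ` with `V = ker ℓ` has a non-zero coefficient OFF the
  chart letter (`e_j + b ∈ V` has `j`-coordinate `1`);
* **`linearForm_step_proportional_off_chart`** (T-PERSIST) — if `V = ker ℓ` (`ℓ ≠ 0`) and `V′ = ker ℓ′` then
  `∃ c ≠ 0, ∀ i ≠ j, ℓ′ i = c * ℓ i`: the new vertex form is `ℓ′ = c·ℓ̃ + ℓ′_j·x_j` with `ℓ̃ = ℓ` minus its chart
  coefficient — idea-4 I-4-7's «`ℓ′ = ℓ̃ + c·x_j′`: sector T persists, one frame serves the whole stretch», here for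
  EVERY `p` and `d` and WITHOUT a constancy hypothesis (it uses only the inclusion `ker ℓ′ ∩ H_j ⊆ ker ℓ ∩ H_j` on
  `H_j ≅ K³`, where both restricted forms are non-zero);
* `apply_ne_zero_step_of_apply_ne_zero` — a letter `i ≠ j` carrying `ℓ` keeps carrying `ℓ′`.

Linear forms are coefficient vectors `ℓ : Fin 4 → K` acting by Mathlib's `dotProduct ℓ w = Σ ℓ_i w_i`.
[cite: CossartJannsenSaito2020, Thm. 3.10(4), Thm. 3.14, Thm. 9.3]
bears_on: LADDER-RESOLUTION:D157-DOOR2 (res-dim4-pi · K2(p) = `RidgeBudget.NoAboveFloorTrap p p`, lower band).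
Supports stmt-ResolutionOfSingularities-16155 (helper).
-/

set_option linter.dupNamespace false -- mandated namespace of this single-conjunct summit

noncomputable section

namespace Summit.ResolutionOfSingularities.ResolutionOfSingularities.Theorems.PIDim4

namespace ResCone

open MvPolynomial Finset
open Literature.AlgebraicGeometry.Resolution
open Literature.AlgebraicGeometry.Resolution.CentreBlowup
open Literature.AlgebraicGeometry.Resolution.Hauser2010
open Literature.AlgebraicGeometry.Resolution.HauserPerlega2019
open PointBlowup (polarMap additiveSubspace direction)

variable {K : Type} [Field K]

/-! ## 1. Coefficient vectors as linear forms -/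

/-- Evaluating a coefficient vector on a basis vector. [folklore] -/
theorem dotProduct_single_one_eq (ℓ : Fin 4 → K) (i : Fin 4) : dotProduct ℓ (Pi.single i 1) = ℓ i :=
  dotProduct_single_one ℓ i

/-- Evaluating a coefficient vector on the direction `e_j + b` of a chart point. [folklore] -/
theorem dotProduct_direction (ℓ : Fin 4 → K) (j : Fin 4) (b : Fin 4 → K) (hbj : b j = 0) :
    dotProduct ℓ (direction j b) = ℓ j + dotProduct ℓ b := by
  have h : direction j b = Pi.single j 1 + b := by
    funext i
    by_cases hij : i = j
    · rw [hij, direction_apply_self, Pi.add_apply, Pi.single_eq_same, hbj, add_zero]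
    · rw [direction_apply_of_ne hij, Pi.add_apply, Pi.single_eq_of_ne hij, zero_add]
  rw [h, dotProduct_add, dotProduct_single_one]

/-! ## 2. Annihilator transport and the persistence of the vertex form -/

section Step

variable [DecidableEq K]

/-- **Annihilator transport** (SAT-LOCATED dualised, any `e_G`): at a shade-keeping band step `s →(j, b) s′`, a
coefficient vector `φ` killing `resVertex s` kills every `w ∈ resVertex s′` with `w_j = 0`. [OURS]
[cite: CossartJannsenSaito2020, Thm. 3.10(4), Thm. 9.3] -/
theorem dotProduct_eq_zero_of_mem_resVertex_step {q : ℕ} (j : Fin 4) {b : Fin 4 → K} (hbj : b j = 0)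
    {s : State K} {o : ℕ} (ho : ordZero s.F = o) (hr : ∀ d ∈ s.F.support, s.r ≤ d) (hqo : q < o)
    (ho2 : o < 2 * q) (heq : (CentreBlowup.step q Finset.univ j b s).shade = s.shade) {φ : Fin 4 → K}
    (hφ : ∀ w ∈ resVertex s, dotProduct φ w = 0) {w : Fin 4 → K}
    (hw : w ∈ resVertex (CentreBlowup.step q Finset.univ j b s)) (hwj : w j = 0) : dotProduct φ w = 0 :=
  hφ w (Submodule.mem_inf.mp (resVertex_step_inf_hyperplane_le_resVertex j hbj ho hr hqo ho2 heq
    (Submodule.mem_inf.mpr ⟨hw, mem_hyperplane.mpr hwj⟩))).1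

/-- **A vertex hyperplane form has a non-zero coefficient OFF the chart letter**: if `resVertex s = ker ℓ` with
`ℓ ≠ 0` and `s →(j, b) s′` keeps the shade, then `ℓ i ≠ 0` for some `i ≠ j` (the direction `e_j + b ∈ resVertex s`
has `j`-coordinate `1`, so `ℓ = ℓ_j x_j` would force `ℓ_j = 0`). [OURS] [cite: CossartJannsenSaito2020, Thm. 3.14] -/
theorem exists_apply_ne_zero_off_chart {q : ℕ} (j : Fin 4) {b : Fin 4 → K} (hbj : b j = 0) {s : State K}
    {o : ℕ} (ho : ordZero s.F = o) (hr : ∀ d ∈ s.F.support, s.r ≤ d) (hqo : q < o) (ho2 : o < 2 * q)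
    (heq : (CentreBlowup.step q Finset.univ j b s).shade = s.shade) {ℓ : Fin 4 → K}
    (hV : ∀ w, w ∈ resVertex s ↔ dotProduct ℓ w = 0) (hℓ : ℓ ≠ 0) : ∃ i, i ≠ j ∧ ℓ i ≠ 0 := by
  by_contra hno
  push Not at hno
  -- `ℓ` kills `b` (all coefficients off `j` vanish and `b_j = 0`), hence `ℓ (e_j + b) = ℓ_j`
  have hb : dotProduct ℓ b = 0 := by
    unfold dotProduct
    refine Finset.sum_eq_zero fun i _ => ?_
    by_cases hij : i = j
    · rw [hij, hbj, mul_zero]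
    · rw [hno i hij, zero_mul]
  have hv := (hV _).mp (direction_mem_resVertex_of_shade_eq j hbj ho hr hqo ho2 heq)
  rw [dotProduct_direction ℓ j b hbj, hb, add_zero] at hv
  apply hℓ
  funext i
  by_cases hij : i = j
  · rw [hij, hv, Pi.zero_apply]
  · rw [hno i hij, Pi.zero_apply]

/-- **(T-PERSIST) — the vertex form persists off the chart letter.**  At a shade-keeping band step `s →(j, b) s′`
with hyperplane vertices `resVertex s = ker ℓ` (`ℓ ≠ 0`) and `resVertex s′ = ker ℓ′`: `∃ c ≠ 0, ∀ i ≠ j,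
ℓ′ i = c * ℓ i`, i.e. `ℓ′ = c·ℓ̃ + ℓ′_j·x_j`.  (idea-4 I-4-7 (VT)(ii) / I47.TPERSIST at cone level, every `p`, every
`d`, no constancy hypothesis.) [OURS] [cite: CossartJannsenSaito2020, Thm. 3.10(4), Thm. 3.14, Thm. 9.3] -/
theorem linearForm_step_proportional_off_chart {q : ℕ} (j : Fin 4) {b : Fin 4 → K} (hbj : b j = 0)
    {s : State K} {o : ℕ} (ho : ordZero s.F = o) (hr : ∀ d ∈ s.F.support, s.r ≤ d) (hqo : q < o)
    (ho2 : o < 2 * q) (heq : (CentreBlowup.step q Finset.univ j b s).shade = s.shade) {ℓ ℓ' : Fin 4 → K}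
    (hV : ∀ w, w ∈ resVertex s ↔ dotProduct ℓ w = 0)
    (hV' : ∀ w, w ∈ resVertex (CentreBlowup.step q Finset.univ j b s) ↔ dotProduct ℓ' w = 0) (hℓ : ℓ ≠ 0) :
    ∃ c : K, c ≠ 0 ∧ ∀ i, i ≠ j → ℓ' i = c * ℓ i := by
  -- transport: `w_j = 0 ∧ ℓ′·w = 0 ⇒ ℓ·w = 0`
  have htr : ∀ w : Fin 4 → K, w j = 0 → dotProduct ℓ' w = 0 → dotProduct ℓ w = 0 := fun w hwj hw =>
    dotProduct_eq_zero_of_mem_resVertex_step j hbj ho hr hqo ho2 heq (fun u hu => (hV u).mp hu)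
      ((hV' w).mpr hw) hwj
  -- Claim A: `ℓ` has a non-zero coefficient off `j`
  obtain ⟨i₀, hi₀j, hi₀⟩ := exists_apply_ne_zero_off_chart j hbj ho hr hqo ho2 heq hV hℓ
  -- Claim B: so does `ℓ′` (else `H_j ⊆ ker ℓ′`, and transport kills `ℓ i₀`)
  obtain ⟨i₁, hi₁j, hi₁⟩ : ∃ i, i ≠ j ∧ ℓ' i ≠ 0 := by
    by_contra hno
    push Not at hno
    have h := htr (Pi.single i₀ 1) (Pi.single_eq_of_ne (Ne.symm hi₀j) _) (by
      rw [dotProduct_single_one]; exact hno i₀ hi₀j)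
    rw [dotProduct_single_one] at h
    exact hi₀ h
  -- Main: for `i ≠ j` test the transport on `w = e_i - (ℓ′ i / ℓ′ i₁) • e_{i₁}`
  have key : ∀ i, i ≠ j → ℓ i * ℓ' i₁ = ℓ i₁ * ℓ' i := by
    intro i hij
    obtain ⟨w, hwdef⟩ : ∃ w : Fin 4 → K, w = Pi.single i 1 - (ℓ' i / ℓ' i₁) • Pi.single i₁ 1 := ⟨_, rfl⟩
    have hwj : w j = 0 := by
      rw [hwdef, Pi.sub_apply, Pi.smul_apply, Pi.single_eq_of_ne (Ne.symm hij),
        Pi.single_eq_of_ne (Ne.symm hi₁j), smul_zero, sub_zero]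
    have hw : dotProduct ℓ' w = 0 := by
      rw [hwdef, dotProduct_sub, dotProduct_smul, dotProduct_single_one, dotProduct_single_one, smul_eq_mul,
        div_mul_cancel₀ _ hi₁, sub_self]
    have h := htr w hwj hw
    rw [hwdef, dotProduct_sub, dotProduct_smul, dotProduct_single_one, dotProduct_single_one, smul_eq_mul,
      sub_eq_zero] at h
    -- `h : ℓ i = ℓ′ i / ℓ′ i₁ * ℓ i₁`
    rw [h, div_mul_eq_mul_div, div_mul_cancel₀ _ hi₁, mul_comm]
  -- the ratio `c = ℓ′ i₁ / ℓ i₁`; first `ℓ i₁ ≠ 0` (test `i = i₀`)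
  have hℓi₁ : ℓ i₁ ≠ 0 := by
    intro h0
    have h := key i₀ hi₀j
    rw [h0, zero_mul] at h
    exact mul_ne_zero hi₀ hi₁ h
  refine ⟨ℓ' i₁ / ℓ i₁, div_ne_zero hi₁ hℓi₁, fun i hij => ?_⟩
  have h := key i hij
  rw [div_mul_eq_mul_div, eq_div_iff hℓi₁]
  linear_combination -h

/-- **A letter carrying the contact form keeps carrying it**: under (T-PERSIST), `ℓ i ≠ 0` for a letter `i ≠ j`
implies `ℓ′ i ≠ 0` (so a free letter `≠ j` on which `ℓ` lives keeps sector T alive at the next stage). [OURS]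
[cite: CossartJannsenSaito2020, Thm. 3.14] -/
theorem apply_ne_zero_step_of_apply_ne_zero {q : ℕ} (j : Fin 4) {b : Fin 4 → K} (hbj : b j = 0)
    {s : State K} {o : ℕ} (ho : ordZero s.F = o) (hr : ∀ d ∈ s.F.support, s.r ≤ d) (hqo : q < o)
    (ho2 : o < 2 * q) (heq : (CentreBlowup.step q Finset.univ j b s).shade = s.shade) {ℓ ℓ' : Fin 4 → K}
    (hV : ∀ w, w ∈ resVertex s ↔ dotProduct ℓ w = 0)
    (hV' : ∀ w, w ∈ resVertex (CentreBlowup.step q Finset.univ j b s) ↔ dotProduct ℓ' w = 0) (hℓ : ℓ ≠ 0)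
    {i : Fin 4} (hij : i ≠ j) (hi : ℓ i ≠ 0) : ℓ' i ≠ 0 := by
  obtain ⟨c, hc, h⟩ := linearForm_step_proportional_off_chart j hbj ho hr hqo ho2 heq hV hV' hℓ
  rw [h i hij]
  exact mul_ne_zero hc hi

end Step

end ResCone

end Summit.ResolutionOfSingularities.ResolutionOfSingularities.Theorems.PIDim4

end
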